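import Literature.MathematicalPhysics.QuantumFieldTheory.Balaban1983to89.B8IdxB8LawsB

/-!
# `Balaban1983to89.B8TowerBondsNonempty` — [Balaban1985RegularSpaces] the bond-set law `B8IdxB8LawsB.IdxB8LawsB` BITES: EVERY law member with
# `Ω₀ = T` has a NONEMPTY constraint-bond class at EVERY truncation — the positive form of «the empty-bond witnesses of referee flag J2′ are
# excluded» (lattice combinatorics of the graded cover (1.4)–(1.6) and of the truncations (1.19)∕(1.34), no analysis)

statement-level skeleton of published theorems with citation tags; proofs; nothing here is a claim about the Yang–Mills mass gap

T. Bałaban, *Spaces of regular gauge field configurations on a lattice and gauge fixing conditions*, Commun. Math. Phys. **99** (1985)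
75–102 `[Balaban1985RegularSpaces]` ("B8"), (1.4)–(1.6) p. 77 (blocks, towers, the graded cover «Ω_j^{(j)} = ⋃_{l ≥ j} B^{l−j}(Λ_l)»),
(1.19) p. 79 ∕ (1.34) p. 82 (the truncated towers), (1.12) p. 78 («𝔅_k = ⋃_j Λ_j (the same for the sets of bonds)», bond convention p. 77)
and (1.31) p. 82 (the inner bonds «b ⊂ Λ_j (i.e. b₋, b₊ ∈ Λ_j)»).

CITATION HEADER (lean-in-tree rule).  Cell `pub-ymgap` (YM Track A, HUMAN RULING D-0062), DAG node N05 = [B8], seat `pub-ymgap-dag-n05-c`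
(g2; director-ym LINE №105 «n05-c TAKES the Λb law»).  WHY.  `B8IdxB8LawsB` (this seat, p465406) typed law №12 — a member's bond classes
ARE the maximal classes `towerBonds` the Λ-tower generates — and certified that the KNOWN empty-bond witnesses (ref-A's `degenerateMember`,
`B8CubeMemberIdxB8Laws.exists_idxB8Sub_bonds_empty`) violate it.  THIS FILE proves the positive statement the b9-socket consumers need:
**at every member of the sub-index of record `IdxB8SubB θ` and every truncation `m ≤ k`, some bond class `Λb m j` (`j ≤ m`) is NONEMPTY**
(`IdxB8SubB.exists_bond_trunc`), so the bond subtype `{p ∣ p.1 ≤ m ∧ p.2 ∈ Λb m p.1}` over which `B8LeafModelZd3.SockB9P3`'s conclusion takes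
its supremum is INHABITED (`IdxB8SubB.nonempty_bondSubtype`) — the mechanism of the certified refutation `RefAProbeG12j.sb9all_false` (an
`iSup` over an empty type) cannot recur on the law-cut family.
HOW (pure lattice combinatorics, §§1–3; the member statements §4):
* §2 **`exists_innerBond_of_cover`** — a tower structure `T` of height `m` whose towers lie in `Ω` and which COVERS level `0` has two ADJACENT
  tops `z, z + e_μ ∈ T j` at some level `j ≤ m` (an inner bond, box inside `Ω_j`): by downward induction on the level, the level-`ℓ` sites under
  NO higher top form whole `L`-blocks (membership depends only on the parent block), so such a site has a block-neighbour of the same kind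
  and both are level-`ℓ` tops; if there is none, level `ℓ + 1` is covered and the induction proceeds; at the top every site is a top.
* §3 the truncation `Λs m` of a law member, read off `Λs k` by №8 iterated: `trunc_eq_top` (`Λs m j = Λs k j`, `j < m`), `mem_trunc_of_mem_top`,
  **`ancestor_mem_trunc_self`** (the level-`m` ancestor of anything under a top of height `≥ m` is in `Λs m m` — «Λ_{k−1} ∪ B(Λ_k) as Λ_{k−1}»
  iterated), **`cover_trunc`** (with `Ω₀ = T`, every truncation covers level `0`), `exists_innerBond_trunc`.
* §4 **`IdxB8LawsB.exists_bond_trunc`** ∕ `exists_bond_top`, **`IdxB8SubB.exists_bond_trunc`**, **`IdxB8SubB.nonempty_bondSubtype`**.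

HONEST SCOPE.  Bookkeeping on print's own index geometry; NO estimate; nothing of [Balaban1985RegularSpaces]'s analysis asserted; whether
`SockB9P3` over `IdxB8SubB` members is PROVABLE is the supplier's theorem ([4] Thm 3.3 content); N05 NOT discharged; counts unmoved; `T_η ↦ ℤᵈ`;
one finite `T⁴` programme at fixed `ε`, Bałaban as printed — nothing continuum ∕ ℝ⁴ ∕ OS ∕ mass-gap ∕ Clay.  No `sorry`, no `axiom`, no
`instance`, no `notation`.  Unit `pub-ymgap-dag-n05-c` (g2), 2026-08-26.
VERSION v1.1 (same seat; module header only, all declarations byte-identical).  LOCATOR ERRATUM (referee ref-E READ-15): the tags «p. 86 («𝔅_k»)»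
in the docstrings below are not a printed sentence — `𝔅_k` is DEFINED at (1.12) p. 78 under the bond convention of p. 77 and its bonds are
classified at (1.31) p. 82 ∕ (1.37) p. 82 ∕ (1.42) p. 83; read every such tag as «(1.12) p. 78 + p. 77; (1.31) p. 82».  TIGHTNESS (ref-E): the
`∃ j ≤ m` of `exists_bond_trunc` is SHARP (the depth-2 `Ω ≡ T` member has `Λb 2 0 = ∅`) — consumers must not assume every level carries a bond.
-/

noncomputable section

namespace Literature.MathematicalPhysics.QuantumFieldTheory.Balaban1983to89.B8IdxB8LawsB

open B7Prop1Explicit B7Prop1Local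
open B8Ineq130 (tlo thi tlo_apply thi_apply)
open B8Ineq132 (Under)
open B8Thm2LogB (blockTop)
open B8LeafModelZd (ZdIdx)
open B8Eq131Cubes (flm under_flm)
open B8Eq131Derivation (under_zero_iff under_one_corner)
open B8Ineq166Univ (flm_under_of_under under_add_of_under under_or_of_box_pair)
open B8Thm4TruncationLocal (mem_blockSites_of_under_one)
open B8CubeMemberZd (inBox_tower_iff_under)
open Node00 (IdxB8Laws IdxB8 IdxB8Sub Stage3Params)

variable {d : ℕ}

/-! ## §1 Block arithmetic -/

/-- Aligned blocks: `x ∈ B^{a+1}(y)` and `x ∈ B(q)` give `q ∈ Bᵃ(y)`. [cite: Balaban1985RegularSpaces, (1.4)–(1.6) p.77, (1.19) p.79, (1.31) p.82, p.86 (bookkeeping: lattice combinatorics)] -/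
theorem under_of_under_succ_of_under_one {L : ℕ} (hL : 1 ≤ L) {a : ℕ} {y q x : B7Prop1Explicit.Site d}
    (hx : Under L (a + 1) y x) (hq : Under L 1 q x) : Under L a y q := by
  have h := flm_under_of_under hL (show 1 ≤ a + 1 by omega) hx
  rw [Nat.add_sub_cancel] at h
  have hq' : flm L 1 x = q := by
    funext i
    obtain ⟨h1, h2⟩ := hq i
    have hL0 : (0 : ℤ) < (L : ℤ) := by exact_mod_cast hL
    rw [pow_one] at h1 h2
    simp only [flm, pow_one]
    have hlo : q i ≤ x i / (L : ℤ) := Int.le_ediv_of_mul_le hL0 (by linarith)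
    have hhi : x i / (L : ℤ) < q i + 1 := Int.ediv_lt_of_lt_mul hL0 (by linarith)
    omega
  rwa [hq'] at h

/-- Inside one `L`-block (`L ≥ 2`, `d ≥ 1`) every site has a neighbour in direction `e₀` in the same block. [cite: Balaban1985RegularSpaces, (1.4)–(1.6) p.77, (1.19) p.79, (1.31) p.82, p.86 (bookkeeping: lattice combinatorics)] -/
theorem exists_adjacent_same_block {L : ℕ} (hL : 2 ≤ L) (hd : 1 ≤ d) {q w : B7Prop1Explicit.Site d} (hw : Under L 1 q w) :
    ∃ w₂ : B7Prop1Explicit.Site d, (w₂ = w + e ⟨0, hd⟩ ∨ w = w₂ + e ⟨0, hd⟩) ∧ Under L 1 q w₂ := by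
  have hL' : (2 : ℤ) ≤ (L : ℤ) := by exact_mod_cast hL
  obtain ⟨h1, h2⟩ := hw ⟨0, hd⟩
  rw [pow_one] at h1 h2
  by_cases hc : w ⟨0, hd⟩ + 2 ≤ (L : ℤ) * (q ⟨0, hd⟩ + 1)
  · refine ⟨w + e ⟨0, hd⟩, Or.inl rfl, fun i => ?_⟩
    by_cases hi : i = ⟨0, hd⟩
    · subst hi
      simp only [Pi.add_apply, e, Pi.single_eq_same, pow_one]
      constructor <;> linarith
    · have he : e (⟨0, hd⟩ : Fin d) i = 0 := by simp [e, hi]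
      simp only [Pi.add_apply, he, add_zero]
      exact hw i
  · refine ⟨w - e ⟨0, hd⟩, Or.inr (by simp), fun i => ?_⟩
    by_cases hi : i = ⟨0, hd⟩
    · subst hi
      simp only [Pi.sub_apply, e, Pi.single_eq_same, pow_one]
      constructor <;> linarith
    · have he : e (⟨0, hd⟩ : Fin d) i = 0 := by simp [e, hi]
      simp only [Pi.sub_apply, he, sub_zero]
      exact hw i

/-- The box of a level-`j` bond `⟨z, z + e_μ⟩` lies in the union of the two towers `Bʲ(z) ∪ Bʲ(z + e_μ)`. [cite: Balaban1985RegularSpaces, (1.4)–(1.6) p.77, (1.19) p.79, (1.31) p.82, p.86 (bookkeeping: lattice combinatorics)] -/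
theorem under_or_of_bondBox {L : ℕ} (j : ℕ) (z : B7Prop1Explicit.Site d) (μ : Fin d) {x : B7Prop1Explicit.Site d}
    (hx : InBox (loK L j z) (bondHiK L j z μ) x) : Under L j z x ∨ Under L j (z + e μ) x := by
  refine under_or_of_box_pair j (Or.inr rfl) (fun i => ?_) (fun i => ?_)
  · rw [tlo_apply]; have := (hx i).1; simpa [loK] using this
  · rw [thi_apply]
    have h := (hx i).2
    simp only [bondHiK] at h
    by_cases hi : i = μ
    · subst hi
      simp only [if_true] at h
      simp only [Pi.add_apply, e, Pi.single_eq_same]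
      linarith
    · simp only [hi, if_false, add_zero] at h
      have he : e μ i = 0 := by simp [e, hi]
      simp only [Pi.add_apply, he, add_zero]
      linarith

/-! ## §2 The covering induction -/

/-- **Core combinatorics of the graded cover.**  Let `T` be a tower structure of height `m` whose towers lie in `Ω` (`Bʲ(y) ⊂ Ω_j` for
`y ∈ T j`) and which COVERS level `0` (every site lies under some top).  Then some level `j ≤ m` carries two ADJACENT tops `z, z + e_μ ∈ T j`
— an inner bond, whose box lies in `Ω_j`.  (Downward induction on the level: the level-`ℓ` sites not under a higher top form whole
`L`-blocks, so contain an adjacent pair, both of which must be level-`ℓ` tops; if there are none, every level-`(ℓ+1)` site is covered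
and we recurse; at the top level every site is a top.) [cite: Balaban1985RegularSpaces, (1.4)–(1.6) p.77, (1.19) p.79, (1.31) p.82, p.86 (bookkeeping: lattice combinatorics)] -/
theorem exists_innerBond_of_cover {L : ℕ} (hL : 2 ≤ L) (hd : 1 ≤ d) (Ω T : ℕ → Set (B7Prop1Explicit.Site d)) (m : ℕ)
    (htw : ∀ j, j ≤ m → ∀ y ∈ T j, ∀ x, Under L j y x → x ∈ Ω j)
    (hcov : ∀ w, ∃ j, j ≤ m ∧ ∃ y ∈ T j, Under L j y w) :
    ∃ j, j ≤ m ∧ ∃ (z : B7Prop1Explicit.Site d) (μ : Fin d), z ∈ T j ∧ z + e μ ∈ T j ∧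
      ∀ x, InBox (loK L j z) (bondHiK L j z μ) x → x ∈ Ω j := by
  have hL1 : 1 ≤ L := le_trans (by norm_num) hL
  -- it suffices to find two adjacent tops at some level: the box clause follows from `htw`
  suffices H : ∃ j, j ≤ m ∧ ∃ (z : B7Prop1Explicit.Site d) (μ : Fin d), z ∈ T j ∧ z + e μ ∈ T j by
    obtain ⟨j, hj, z, μ, hz, hz'⟩ := H
    refine ⟨j, hj, z, μ, hz, hz', fun x hx => ?_⟩
    rcases under_or_of_bondBox j z μ hx with h | h
    · exact htw j hj z hz x h
    · exact htw j hj _ hz' x h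
  -- downward induction on the level `ℓ = m - n`, with the coverage hypothesis transported upward
  suffices S : ∀ n ℓ, ℓ + n = m → (∀ w, ∃ j, ℓ ≤ j ∧ j ≤ m ∧ ∃ y ∈ T j, Under L (j - ℓ) y w) →
      ∃ j, j ≤ m ∧ ∃ (z : B7Prop1Explicit.Site d) (μ : Fin d), z ∈ T j ∧ z + e μ ∈ T j by
    refine S m 0 (Nat.zero_add m) fun w => ?_
    obtain ⟨j, hj, y, hy, hU⟩ := hcov w
    exact ⟨j, Nat.zero_le j, hj, y, hy, by rw [Nat.sub_zero]; exact hU⟩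
  intro n
  induction n with
  | zero =>
    intro ℓ hℓ hcovℓ
    rw [Nat.add_zero] at hℓ
    subst hℓ
    -- at the top level every site is a top
    have htop : ∀ w, w ∈ T ℓ := by
      intro w
      obtain ⟨j, hj1, hj2, y, hy, hU⟩ := hcovℓ w
      obtain rfl : j = ℓ := le_antisymm hj2 hj1
      rw [Nat.sub_self] at hU
      rw [(under_zero_iff L y w).1 hU]
      exact hy
    exact ⟨ℓ, le_rfl, 0, ⟨0, hd⟩, htop _, htop _⟩
  | succ n ih =>
    intro ℓ hℓ hcovℓ
    by_cases hU : ∃ w, ¬ ∃ j, ℓ < j ∧ j ≤ m ∧ ∃ y ∈ T j, Under L (j - ℓ) y w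
    · -- a site under no higher top: it and its block-neighbour are level-`ℓ` tops
      obtain ⟨w, hw⟩ := hU
      have htopℓ : ∀ w', (¬ ∃ j, ℓ < j ∧ j ≤ m ∧ ∃ y ∈ T j, Under L (j - ℓ) y w') → w' ∈ T ℓ := by
        intro w' hw'
        obtain ⟨j, hj1, hj2, y, hy, hUy⟩ := hcovℓ w'
        rcases Nat.lt_or_ge ℓ j with hlt | hge
        · exact absurd ⟨j, hlt, hj2, y, hy, hUy⟩ hw'
        · obtain rfl : j = ℓ := le_antisymm hge hj1
          rw [Nat.sub_self] at hUy
          rw [(under_zero_iff L y w').1 hUy]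
          exact hy
      -- the neighbour in the same `L`-block is under no higher top either
      obtain ⟨w₂, hw₂, hq₂⟩ := exists_adjacent_same_block hL hd (under_flm hL1 1 w)
      have hw₂U : ¬ ∃ j, ℓ < j ∧ j ≤ m ∧ ∃ y ∈ T j, Under L (j - ℓ) y w₂ := by
        rintro ⟨j, hj1, hj2, y, hy, hUy⟩
        apply hw
        refine ⟨j, hj1, hj2, y, hy, ?_⟩
        obtain ⟨a, ha⟩ : ∃ a, j - ℓ = a + 1 := ⟨j - ℓ - 1, by omega⟩
        rw [ha] at hUy ⊢
        exact under_add_of_under (under_of_under_succ_of_under_one hL1 hUy hq₂) (under_flm hL1 1 w)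
      have h1 := htopℓ w hw
      have h2 := htopℓ w₂ hw₂U
      rcases hw₂ with rfl | rfl
      · exact ⟨ℓ, by omega, w, ⟨0, hd⟩, h1, h2⟩
      · exact ⟨ℓ, by omega, w₂, ⟨0, hd⟩, h2, h1⟩
    · -- every level-`ℓ` site lies under a higher top: level `ℓ + 1` is covered, recurse
      push Not at hU
      refine ih (ℓ + 1) (by omega) fun w' => ?_
      obtain ⟨j, hj1, hj2, y, hy, hUy⟩ := hU ((L : ℤ) • w')
      obtain ⟨a, ha⟩ : ∃ a, j - ℓ = a + 1 := ⟨j - ℓ - 1, by omega⟩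
      rw [ha] at hUy
      refine ⟨j, hj1, hj2, y, hy, ?_⟩
      rw [show j - (ℓ + 1) = a by omega]
      exact under_of_under_succ_of_under_one hL1 hUy (under_one_corner hL1 w')

/-! ## §3 Truncations of a law member (№8 iterated) -/

/-- Below a truncation level the constraint sets are the top ones: `Λs m j = Λs k j` for `j < m ≤ k` (№8 `trunc_lt` iterated). [cite: Balaban1985RegularSpaces, (1.4)–(1.6) p.77, (1.19) p.79, (1.31) p.82, p.86 (bookkeeping: lattice combinatorics)] -/
theorem trunc_eq_top {L : ℕ} {i : ZdIdx d L} (h : IdxB8Laws L i) {j m : ℕ} (hjm : j < m) (hm : m ≤ i.k) :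
    i.Λs m j = i.Λs i.k j := by
  obtain ⟨n, hn⟩ : ∃ n, m + n = i.k := ⟨i.k - m, by omega⟩
  induction n generalizing m with
  | zero => rw [Nat.add_zero] at hn; rw [hn]
  | succ n ih =>
    rw [h.trunc_lt m (by omega) j hjm]
    exact ih (by omega) (by omega) (by omega)

/-- A top of the full structure is a top of every truncation above its own level: `y ∈ Λs k j`, `j ≤ m′ ≤ k` ⇒ `y ∈ Λs m′ j`. [cite: Balaban1985RegularSpaces, (1.4)–(1.6) p.77, (1.19) p.79, (1.31) p.82, p.86 (bookkeeping: lattice combinatorics)] -/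
theorem mem_trunc_of_mem_top {L : ℕ} {i : ZdIdx d L} (h : IdxB8Laws L i) {j : ℕ} {y : B7Prop1Explicit.Site d}
    (hy : y ∈ i.Λs i.k j) : ∀ m', j ≤ m' → m' ≤ i.k → y ∈ i.Λs m' j := by
  suffices H : ∀ n m', m' + n = i.k → j ≤ m' → y ∈ i.Λs m' j by
    intro m' h1 h2; exact H (i.k - m') m' (by omega) h1
  intro n
  induction n with
  | zero => intro m' hm' _; rw [Nat.add_zero] at hm'; rw [hm']; exact hy
  | succ n ih =>
    intro m' hm' hjm'
    have hmk : m' < i.k := by omega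
    have hup := ih (m' + 1) (by omega) (by omega)
    rcases Nat.lt_or_ge j m' with hlt | hge
    · rw [h.trunc_lt m' hmk j hlt]; exact hup
    · obtain rfl : j = m' := le_antisymm hjm' hge
      exact (h.trunc_top j hmk y).2 (Or.inl hup)

/-- **Projection of high tops**: the level-`m` ancestor of anything under a top `y ∈ Λs k j` of height `j ≥ m` is a top of the truncation at
`m`: `Under L (j − m) y y′ ⇒ y′ ∈ Λs m m` (№8 `trunc_top` iterated: «Λ_{k−1} ∪ B(Λ_k) as Λ_{k−1}»). [cite: Balaban1985RegularSpaces, (1.4)–(1.6) p.77, (1.19) p.79, (1.31) p.82, p.86 (bookkeeping: lattice combinatorics)] -/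
theorem ancestor_mem_trunc_self {L : ℕ} (hL : 1 ≤ L) {i : ZdIdx d L} (h : IdxB8Laws L i) :
    ∀ n m, m + n ≤ i.k → ∀ y ∈ i.Λs i.k (m + n), ∀ y', Under L n y y' → y' ∈ i.Λs m m := by
  intro n
  induction n with
  | zero =>
    intro m hm y hy y' hU
    rw [Nat.add_zero] at hm hy
    rw [(under_zero_iff L y y').1 hU]
    exact mem_trunc_of_mem_top h hy m le_rfl hm
  | succ n ih =>
    intro m hm y hy y' hU
    -- the level-`(m+1)` ancestor `q` of `y′`
    have hq : Under L n y (flm L 1 y') := under_of_under_succ_of_under_one hL hU (under_flm hL 1 y')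
    have hq' : flm L 1 y' ∈ i.Λs (m + 1) (m + 1) :=
      ih (m + 1) (by omega) y (by rw [show m + 1 + n = m + (n + 1) by omega]; exact hy) _ hq
    exact (h.trunc_top m (by omega) y').2 (Or.inr ⟨_, hq', mem_blockSites_of_under_one (under_flm hL 1 y')⟩)

/-- **Every truncation of a law member with `Ω₀ = T` covers level 0**: every site lies under a top of `Λs m`, `m ≤ k`. [cite: Balaban1985RegularSpaces, (1.4)–(1.6) p.77, (1.19) p.79, (1.31) p.82, p.86 (bookkeeping: lattice combinatorics)] -/
theorem cover_trunc {L : ℕ} (hL : 1 ≤ L) {i : ZdIdx d L} (h : IdxB8Laws L i) (h0 : i.Ω 0 = Set.univ) {m : ℕ} (hm : m ≤ i.k) :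
    ∀ w, ∃ j, j ≤ m ∧ ∃ y ∈ i.Λs m j, Under L j y w := by
  intro w
  obtain ⟨j, -, hjk, y, hy, hU⟩ := h.cover 0 (Nat.zero_le _) w (fun x _ => by rw [h0]; exact Set.mem_univ x)
  rw [Nat.sub_zero] at hU
  rcases Nat.lt_or_ge j m with hlt | hge
  · exact ⟨j, hlt.le, y, by rw [trunc_eq_top h hlt hm]; exact hy, hU⟩
  · -- project the top down to the truncation level `m`
    refine ⟨m, le_rfl, flm L m w, ?_, under_flm hL m w⟩
    have hsplit : Under L (j - m) y (flm L m w) := flm_under_of_under hL hge hU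
    exact ancestor_mem_trunc_self hL h (j - m) m (by omega) y (by rw [Nat.add_sub_cancel' hge]; exact hy) _ hsplit

/-- **MAIN**: a law member with `Ω₀ = T` (`L ≥ 2`, `d ≥ 1`) has, at EVERY truncation `m ≤ k`, a level `j ≤ m` with two adjacent tops
`z, z + e_μ ∈ Λs m j` whose bond box lies in `Ω_j` — an inner bond of the tower-generated class. [cite: Balaban1985RegularSpaces, (1.4)–(1.6) p.77, (1.19) p.79, (1.31) p.82, p.86 (bookkeeping: lattice combinatorics)] -/
theorem exists_innerBond_trunc {L : ℕ} (hL : 2 ≤ L) (hd : 1 ≤ d) {i : ZdIdx d L} (h : IdxB8Laws L i) (h0 : i.Ω 0 = Set.univ)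
    {m : ℕ} (hm : m ≤ i.k) :
    ∃ j, j ≤ m ∧ ∃ (z : B7Prop1Explicit.Site d) (μ : Fin d), z ∈ i.Λs m j ∧ z + e μ ∈ i.Λs m j ∧
      ∀ x, InBox (loK L j z) (bondHiK L j z μ) x → x ∈ i.Ω j := by
  have hL1 : 1 ≤ L := le_trans (by norm_num) hL
  refine exists_innerBond_of_cover hL hd i.Ω (i.Λs m) m (fun j hj y hy x hx => ?_) (cover_trunc hL1 h h0 hm)
  exact h.tower_all m hm j hj y hy x ((inBox_tower_iff_under L j y x).2 hx)


/-! ## §4 The member-level statements -/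

/-- **EVERY LAW MEMBER WITH `Ω₀ = T` HAS A NONEMPTY BOND CLASS AT EVERY TRUNCATION** (`L ≥ 2`, `d ≥ 1`): for `m ≤ k` some `Λb m j`, `j ≤ m`,
contains an inner bond (№12 `IdxB8LawsB.bonds` + `exists_innerBond_trunc`).  The positive form of «the empty-bond witnesses of flag J2′ are
excluded». [cite: Balaban1985RegularSpaces, p.86 («𝔅_k»), (1.31) p.82, (1.6) p.77, (1.19) p.79 (bookkeeping: lattice combinatorics)] -/
theorem IdxB8LawsB.exists_bond_trunc {L : ℕ} (hL : 2 ≤ L) (hd : 1 ≤ d) {i : ZdIdx d L} (h : IdxB8LawsB L i)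
    (h0 : i.Ω 0 = Set.univ) {m : ℕ} (hm : m ≤ i.k) : ∃ j, j ≤ m ∧ (i.Λb m j).Nonempty := by
  obtain ⟨j, hj, z, μ, hz, hz', hbox⟩ := exists_innerBond_trunc hL hd h.toIdxB8Laws h0 hm
  exact ⟨j, hj, (z, μ), (h.mem_iff m j (z, μ)).2 ⟨hbox, Or.inl ⟨hz, hz'⟩⟩⟩

/-- The same at the top truncation `m = k`. [cite: Balaban1985RegularSpaces, p.86 («𝔅_k») (bookkeeping)] -/
theorem IdxB8LawsB.exists_bond_top {L : ℕ} (hL : 2 ≤ L) (hd : 1 ≤ d) {i : ZdIdx d L} (h : IdxB8LawsB L i)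
    (h0 : i.Ω 0 = Set.univ) : ∃ j, j ≤ i.k ∧ (i.Λb i.k j).Nonempty :=
  h.exists_bond_trunc hL hd h0 le_rfl

/-- **ON THE SUB-INDEX OF RECORD `IdxB8SubB θ` every member has a nonempty bond class at every truncation `m ≤ k`** (`θ.L ≥ 2`,
`θ.D = d₆ + 1 ≥ 1`, `Ω₀ = T` by g31's `IdxB8`). [cite: Balaban1985RegularSpaces, p.86 («𝔅_k») (bookkeeping)] -/
theorem IdxB8SubB.exists_bond_trunc {θ : Stage3Params} (i : IdxB8SubB θ) {m : ℕ} (hm : m ≤ i.1.1.k) :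
    ∃ j, j ≤ m ∧ (i.1.1.Λb m j).Nonempty :=
  i.2.exists_bond_trunc θ.two_le_L (by have := θ.hd₆; omega) i.1.2 hm

/-- **The b9-socket binder's bond subtype `{p ∣ p.1 ≤ m ∧ p.2 ∈ Λb m p.1}` is INHABITED at every member of `IdxB8SubB θ`** and every
truncation `m ≤ k` — the supremum in `B8LeafModelZd3.SockB9P3`'s conclusion is NOT over an empty type there (the mechanism of ref-A's
certified refutation `RefAProbeG12j.sb9all_false`). [cite: Balaban1985RegularSpaces, (1.59) p.86, p.86 («𝔅_k») (bookkeeping)] -/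
theorem IdxB8SubB.nonempty_bondSubtype {θ : Stage3Params} (i : IdxB8SubB θ) {m : ℕ} (hm : m ≤ i.1.1.k) :
    Nonempty {p : ℕ × (B7Prop1Explicit.Site θ.D × Fin θ.D) // p.1 ≤ m ∧ p.2 ∈ i.1.1.Λb m p.1} := by
  obtain ⟨j, hj, c, hc⟩ := i.exists_bond_trunc hm
  exact ⟨⟨(j, c), hj, hc⟩⟩

#print axioms exists_innerBond_of_cover
#print axioms IdxB8SubB.nonempty_bondSubtype

end Literature.MathematicalPhysics.QuantumFieldTheory.Balaban1983to89.B8IdxB8LawsB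

end
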